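import Mathlib
import Summits.ResolutionOfSingularities.ResolutionOfSingularities.Theorems.WeightedInvariantLocalWeightedDropMonicDescentBridge
import Summits.ResolutionOfSingularities.ResolutionOfSingularities.Theorems.WeightedInvariantLocalWeightedDropMonicDescentPrepExists
import Summits.ResolutionOfSingularities.ResolutionOfSingularities.Theorems.WeightedInvariantLocalWeightedDropMonicDescentNoChain

/-!
# `WeightedInvariant.LocalWeightedDrop`: the registered stub `stub_monicDoublePointDescends` of skeleton v28 — BY NAME

Crux item stmt-ResolutionOfSingularities-8899 `LocalWeightedDrop` (route `ResolutionOfSingularities/WeightedInvariant`), door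
`HypersurfaceCentreConstruction` stmt-ResolutionOfSingularities-19897; registered skeleton v28 (sha16 b8b73808bd522080, line `hasse-ridge-face-selection`,
registrar res-L1-w43-lead-1).  [OURS · L1 W4.3, chain w43; closing file of the N4″ line (pieces T-1′ / T-6′ / T-5′); filed by res-type-056 after landing T-6′,
res-L1-w43-lead-1's session having ended (HANDOFF 04:51:41Z names exactly this composition).  Nothing here is a statement of any manuscript.]

Over an algebraically closed field of characteristic `2`, EVERY REDUCED POSITION `y² + A₁y + A₀` (`ord A₀ ≥ 3`, `ord A₁ ≥ 2`, not a double plane)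
of the descent game on monic double points DESCENDS (`MonicDescent.Descends`: the ordinal-staged attractor of `…MonicDescentDefs`).  Proof = the
composition `MonicDescent.descends_of_pieces` (p488513) of
* T-1′ `MonicDescent.monicDescentPrep` (p494822, res-L1-w43-lead-1): well-preparing re-centrings exist (Hironaka's vertex preparation, label form);
* T-6′ `MonicDescent.monicDescentBridge` (res-type-056, …MonicDescentBridge*): the move of the strategy Σ** satisfies the clauses of the game, every
  singular slice being hyperbolic or re-presented by a well-prepared successor label;
* T-5′ `MonicDescent.monicDescentNoChain` (p493102, res-L1-w43-lead-1): no infinite Σ**-chain of well-prepared reduced positions (β-monotonicity +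
  the tail argument, Cossart–Jannsen–Saito Thm 13.7 / Claim 13.8 as a map).
Consumers already in the tree: `formalStep_of_descends` (N4″, …MonicDescentDefs) ⇒ `charTwoDoublePointSurfaceWon_of_reducedFormalRank` (S2, p482941);
the class keys S2iM / S2sP close by name from this stub via res-D-pv-056's p496875.
-/

set_option linter.dupNamespace false -- mandated namespace of this single-conjunct summit

namespace Summit.ResolutionOfSingularities.ResolutionOfSingularities.Theorems

/-- REGISTERED STUB `stub_monicDoublePointDescends` OF SKELETON v28 (crux `LocalWeightedDrop`, stmt-ResolutionOfSingularities-8899), BY NAME and with the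
registered signature: over an algebraically closed field of characteristic `2`, every reduced position of the descent game on monic double points
descends.  `descends_of_pieces monicDescentPrep (monicDescentBridge monicDescentPrep) (monicDescentNoChain monicDescentPrep)`. -/
theorem stub_monicDoublePointDescends : ∀ (k : Type) [Field k] [CharP k 2] [IsAlgClosed k] (A₀ A₁ : MvPowerSeries (Fin 2) k),
    MonicDescent.IsPosition A₀ A₁ → ¬ MonicDescent.IsDoublePlane A₀ A₁ → MonicDescent.Descends A₀ A₁ :=
  MonicDescent.descends_of_pieces MonicDescent.monicDescentPrep (MonicDescent.monicDescentBridge MonicDescent.monicDescentPrep)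
    (MonicDescent.monicDescentNoChain MonicDescent.monicDescentPrep)

end Summit.ResolutionOfSingularities.ResolutionOfSingularities.Theorems
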